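import Literature.Barriers.QuantumAdvantage.BoundedEntanglementGramZUpdate
import Literature.Computability.Complexity.LengthCompare
import Literature.Computability.Complexity.ProbabilisticClassesProofs
import HarnessLib

/-!
# Reading the verdict off the block data; the `p`-blocked simulation theorem reduced to its machine half

Topic `Literature/Barriers/QuantumAdvantage`; seventh file of the proof programme for the named fact
`Literature.Barriers.QuantumAdvantage.jozsaLinden2003_pblocked` (Jozsa–Linden 2003, §3, theorem
`pblthm` via lemma `ratpbl`). The last step of the simulation is: "we identify the block containing
the leftmost qubit, compute the probability distribution `𝒫` and sample it once" — for a
bounded-error *decision* algorithm no sampling is needed: the exact acceptance probability is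
compared with `1/2` (Jozsa–Linden §2: a finite-tolerance simulation already gives a `BPP`
algorithm; here the simulation is exact, so the language is even in `P`). This file proves the
read-out and assembles the theorem *conditionally on its machine half* (no named fact is introduced):

* `blockOf P i` — the block of a wire in a block partition (`blockOf_mem`, `mem_blockOf`);
* `two_pow_mul_acceptProbOn` — `2^h · Pr[wire 0 reads 1] = ∑_{u ∈ cfg B, u₀ = 1} zwVal (gramZ B (ampZ J) u u)`
  for any wire set `B ∋ 0` (`J` = size, `h` = Hadamard count);
* `diagSumZ F x` — that sum in `ℤ[ω]`-coordinates over the block of wire `0` after the last gate,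
  `pDecision F x` — the exact sign test `posSqrtTwoTest (2 d₀ - 2^h) (2 d₁)` of `StateVectorDP.lean`
  on its coordinates, and **`pDecision_eq_true_iff`**: `pDecision F x ↔ 1/2 < Pr[accept]`
  (the sum is real, so its coordinates are `(d₀, d₁, 0, -d₁)` with value `d₀ + d₁√2 = 2^h Pr`);
* **`jozsaLinden2003_pblocked_of_decisionInFP`**: the catalogue fact from its machine half, taken as
  the hypothesis "for an oracle-free, poly-time uniform Clifford+`T` family with `p`-blocked states,
  `x ↦ [pDecision F x]` is in `FP`" — what the polynomial-time machine of lemma `ratpbl` computes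
  (block locations and block data updated gate by gate with the identities of
  `BoundedEntanglementGramZUpdate.lean`, tables of bounded size by `card_touchUnion_blocksAfter_le`),
  to be established by programming it in the tree's `FP` brick algebra (as
  `QuantumComplexity/ADHMachine.lean` does for `BQP ⊆ PP`); then `mem_P_of_mem_FP` and `P ⊆ BPP`
  (`P_subset_BPP_holds`).

## References

* R. Jozsa, N. Linden, *On the role of entanglement in quantum-computational speed-up*, Proc. R.
  Soc. Lond. A 459 (2003) 2011–2032, arXiv:quant-ph/0201143: §2 (finite tolerance suffices for a
  `BPP` algorithm), §3 (proof of lemma `ratpbl`, final step; theorem `pblthm`).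
* J. Gill, *Computational complexity of probabilistic Turing machines*, SIAM J. Comput. 6 (1977),
  Prop. 5.1 (`P ⊆ BPP`).
-/

noncomputable section

namespace Literature.Barriers.QuantumAdvantage

open Finset Matrix Literature.Computability.Cryptography Literature.Computability.QuantumComplexity
  Literature.Computability.Complexity

variable {N : ℕ}

/-! ### The block of a wire -/

/-- The block of the wire `i` in the family of blocks `P` (the union of the blocks containing `i`;
the unique such block for a block partition). [cite: JozsaLinden2003, §3 (proof of lemma ratpbl: "identify the block containing the leftmost qubit")] -/
def blockOf (P : Finset (Finset (Fin N))) (i : Fin N) : Finset (Fin N) :=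
  (P.filter fun B => i ∈ B).sup id

/-- In a block partition the block of a wire is a block. [folklore] -/
theorem blockOf_eq_of_mem {ψ : QReg N → ℂ} {P : Finset (Finset (Fin N))} (hP : IsBlockPartition ψ P)
    {i : Fin N} {B : Finset (Fin N)} (hB : B ∈ P) (hi : i ∈ B) : blockOf P i = B := by
  have hfilter : P.filter (fun B' => i ∈ B') = {B} := by
    ext B'
    simp only [mem_filter, mem_singleton]
    exact ⟨fun h => hP.eq_of_mem h.1 hB h.2 hi, fun h => h ▸ ⟨hB, hi⟩⟩
  rw [blockOf, hfilter, sup_singleton, id]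

/-- In a block partition the block of a wire is a block. [folklore] -/
theorem blockOf_mem {ψ : QReg N → ℂ} {P : Finset (Finset (Fin N))} (hP : IsBlockPartition ψ P)
    (i : Fin N) : blockOf P i ∈ P := by
  obtain ⟨B, hB, hi⟩ := hP.cover i
  rwa [blockOf_eq_of_mem hP hB hi]

/-- A wire lies in its block. [folklore] -/
theorem mem_blockOf {ψ : QReg N → ℂ} {P : Finset (Finset (Fin N))} (hP : IsBlockPartition ψ P)
    (i : Fin N) : i ∈ blockOf P i := by
  obtain ⟨B, hB, hi⟩ := hP.cover i
  rwa [blockOf_eq_of_mem hP hB hi]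

/-! ### The acceptance probability from the data of a block containing wire `0` -/

section Family

variable (F : QCircuitFamily cliffordT) (x : List Bool)

/-- **Read-out**: with `J` the size and `h` the Hadamard count, for any wire set `B` containing
wire `0`, `2^h · Pr[wire 0 reads 1] = ∑_{u ∈ cfg B, u₀ = 1} zwVal (gramZ B (ampZ J) u u)` — the
diagonal of the block data of the block containing the measured qubit.
[cite: JozsaLinden2003, §3 (proof of lemma ratpbl, final step)] -/
theorem two_pow_mul_acceptProbOn (hF : F.IsOracleFree) (hN : 0 < x.length + F.ancillas x.length)
    {B : Finset (Fin (x.length + F.ancillas x.length))} (h0 : (⟨0, hN⟩ : Fin _) ∈ B) :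
    (2 : ℂ) ^ F.hExp x (F.circ x.length).gates.length * (F.acceptProbOn 0 x : ℂ) =
      ∑ u ∈ cfg B, if u ⟨0, hN⟩ = true then
        ZW.zwVal (gramZ B (F.ampZ x (F.circ x.length).gates.length) u u) else 0 := by
  -- the acceptance probability as a sum of squared moduli of the final state
  have hacc : (F.acceptProbOn 0 x : ℂ) =
      ∑ y : QReg (x.length + F.ancillas x.length),
        if y ⟨0, hN⟩ = true then
          ((‖F.stateAfter x (F.circ x.length).gates.length y‖ ^ 2 : ℝ) : ℂ) else 0 := by
    unfold QCircuitFamily.acceptProbOn QCircuit.acceptProb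
    rw [Complex.ofReal_sum]
    refine sum_congr rfl fun y _ => ?_
    rw [dif_pos hN, runOn_eq_stateAfter]
    split_ifs <;> simp
  -- squared moduli of the rescaled integral state
  have hsq : ∀ y, ZW.zwVal (F.ampZ x (F.circ x.length).gates.length y) *
      starRingEnd ℂ (ZW.zwVal (F.ampZ x (F.circ x.length).gates.length y)) =
        (2 : ℂ) ^ F.hExp x (F.circ x.length).gates.length *
          ((‖F.stateAfter x (F.circ x.length).gates.length y‖ ^ 2 : ℝ) : ℂ) := by
    intro y
    rw [zwVal_ampZ F x hF _ y, map_mul, Complex.ofReal_pow, ← Complex.mul_conj']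
    have := sqrt_two_pow_mul_conj (F.hExp x (F.circ x.length).gates.length)
    linear_combination (F.stateAfter x (F.circ x.length).gates.length y *
      starRingEnd ℂ (F.stateAfter x (F.circ x.length).gates.length y)) * this
  rw [hacc, Finset.mul_sum]
  have hlhs : ∀ y : QReg (x.length + F.ancillas x.length),
      (2 : ℂ) ^ F.hExp x (F.circ x.length).gates.length *
        (if y ⟨0, hN⟩ = true then
          ((‖F.stateAfter x (F.circ x.length).gates.length y‖ ^ 2 : ℝ) : ℂ) else 0) =
        if y ⟨0, hN⟩ = true then
          ZW.zwVal (F.ampZ x (F.circ x.length).gates.length y) *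
            starRingEnd ℂ (ZW.zwVal (F.ampZ x (F.circ x.length).gates.length y)) else 0 := by
    intro y
    split_ifs
    · rw [hsq]
    · rw [mul_zero]
  rw [Finset.sum_congr rfl fun y _ => hlhs y,
    sum_ite_mul_conj_eq_sum_cfg_gram h0 (fun y => ZW.zwVal (F.ampZ x (F.circ x.length).gates.length y))]
  refine sum_congr rfl fun u _ => ?_
  split_ifs
  · rw [zwVal_gramZ]
  · rfl

/-- **The diagonal sum** `∑_{u ∈ cfg B₀, u₀ = 1} gramZ B₀ (ampZ J) u u` in `ℤ[ω]`-coordinates, over the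
block `B₀` of wire `0` after the last gate (`0` on the empty register).
[cite: JozsaLinden2003, §3 (proof of lemma ratpbl, final step)] -/
def diagSumZ : ZW :=
  if hN : 0 < x.length + F.ancillas x.length then
    ∑ u ∈ cfg (blockOf (blocksAfter F x (F.circ x.length).gates.length) ⟨0, hN⟩),
      if u ⟨0, hN⟩ = true then
        gramZ (blockOf (blocksAfter F x (F.circ x.length).gates.length) ⟨0, hN⟩)
          (F.ampZ x (F.circ x.length).gates.length) u u
      else 0
  else 0

/-- The value of the diagonal sum is `2^h · Pr[accept]`. [cite: JozsaLinden2003, §3 (proof of lemma ratpbl, final step)] -/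
theorem zwVal_diagSumZ (hF : F.IsOracleFree) (hN : 0 < x.length + F.ancillas x.length) :
    ZW.zwVal (diagSumZ F x) =
      (2 : ℂ) ^ F.hExp x (F.circ x.length).gates.length * (F.acceptProbOn 0 x : ℂ) := by
  rw [diagSumZ, dif_pos hN, ZW.zwVal_sum,
    two_pow_mul_acceptProbOn F x hF hN
      (mem_blockOf (isBlockPartition_blocksAfter (F := F) (x := x) hF _) ⟨0, hN⟩)]
  refine sum_congr rfl fun u _ => ?_
  split_ifs
  · rfl
  · exact ZW.zwVal_zero

/-- A real element of `ℤ[ω]` has coordinates `(z₀, z₁, 0, -z₁)` and value `z₀ + z₁ √2`. [folklore] -/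
theorem ZW_coords_of_im_eq_zero {z : ZW} (h : (ZW.zwVal z).im = 0) :
    z 2 = 0 ∧ z 3 = -z 1 ∧ (ZW.zwVal z).re = z 0 + z 1 * Real.sqrt 2 := by
  rw [ZW.zwVal_im] at h
  have h' : ((z 2 : ℤ) : ℝ) + ((z 1 + z 3 : ℤ) : ℝ) * (Real.sqrt 2 / 2) = 0 := by
    push_cast
    exact h
  obtain ⟨h2, h13⟩ := ZW.int_add_int_mul_sqrt_two_half_eq_zero h'
  refine ⟨h2, by omega, ?_⟩
  rw [ZW.zwVal_re, show z 3 = -z 1 by omega]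
  push_cast
  ring

/-- **The decision bit**: the exact sign test `posSqrtTwoTest (2 d₀ - 2^h) (2 d₁)` on the coordinates of
the diagonal sum (`false` on the empty register). This is the Boolean the classical machine outputs.
[cite: JozsaLinden2003, §2 ("the decision problem will have a classical efficient (BPP) algorithm") and §3 (proof of lemma ratpbl, final step)] -/
def pDecision : Bool :=
  if 0 < x.length + F.ancillas x.length then
    posSqrtTwoTest (2 * diagSumZ F x 0 - 2 ^ F.hExp x (F.circ x.length).gates.length) (2 * diagSumZ F x 1)
  else false

/-- On the empty register the acceptance probability is `0` (there is no wire `0`). [folklore] -/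
theorem acceptProbOn_eq_zero_of_eq_zero (hN : x.length + F.ancillas x.length = 0) : F.acceptProbOn 0 x = 0 := by
  unfold QCircuitFamily.acceptProbOn QCircuit.acceptProb
  exact Finset.sum_eq_zero fun y _ => by rw [dif_neg (by omega)]

/-- **The decision bit is correct**: `pDecision F x = true ↔ 1/2 < Pr[wire 0 reads 1]`.
[cite: JozsaLinden2003, §3 (proof of lemma ratpbl, final step) with §2] -/
theorem pDecision_eq_true_iff (hF : F.IsOracleFree) : pDecision F x = true ↔ 1 / 2 < F.acceptProbOn 0 x := by
  unfold pDecision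
  by_cases hN : 0 < x.length + F.ancillas x.length
  · rw [if_pos hN, posSqrtTwoTest_iff]
    have hval := zwVal_diagSumZ F x hF hN
    have hcast : (2 : ℂ) ^ F.hExp x (F.circ x.length).gates.length * (F.acceptProbOn 0 x : ℂ) =
        (((2 : ℝ) ^ F.hExp x (F.circ x.length).gates.length * F.acceptProbOn 0 x : ℝ) : ℂ) := by
      push_cast
      ring
    rw [hcast] at hval
    have him : (ZW.zwVal (diagSumZ F x)).im = 0 := by
      rw [hval, Complex.ofReal_im]
    obtain ⟨-, -, hre⟩ := ZW_coords_of_im_eq_zero him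
    have hre' : (ZW.zwVal (diagSumZ F x)).re =
        (2 : ℝ) ^ F.hExp x (F.circ x.length).gates.length * F.acceptProbOn 0 x := by
      rw [hval, Complex.ofReal_re]
    rw [hre'] at hre
    have h2 : (0 : ℝ) < (2 : ℝ) ^ F.hExp x (F.circ x.length).gates.length := by positivity
    push_cast
    constructor
    · intro h
      nlinarith
    · intro h
      nlinarith
  · rw [if_neg hN, acceptProbOn_eq_zero_of_eq_zero F x (by omega)]
    norm_num

/-- For a bounded-error family, membership is the decision bit. [cite: JozsaLinden2003, §2] -/
theorem mem_iff_pDecision (hF : F.IsOracleFree) {L : Language Bool}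
    (hacc : ∀ x, (x ∈ L → 2 / 3 ≤ F.acceptProbOn 0 x) ∧ (x ∉ L → F.acceptProbOn 0 x ≤ 1 / 3)) (x : List Bool) :
    x ∈ L ↔ pDecision F x = true := by
  rw [pDecision_eq_true_iff F x hF]
  constructor
  · intro hx
    linarith [(hacc x).1 hx]
  · intro h
    by_contra hx
    linarith [(hacc x).2 hx]

end Family

/-! ### The theorem conditional on its machine half -/

/-- **Jozsa–Linden's theorem `pblthm` from its machine half.** The remaining (machine) half of the
proof of lemma `ratpbl` is the hypothesis `h`: for every `p` and every oracle-free, polynomial-time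
uniform family of Clifford+`T` circuits all of whose intermediate states are `p`-blocked, the decision
bit `x ↦ [pDecision F x]` — the exact sign test on the diagonal of the block data of the block
containing wire `0` after the last gate — is computable in polynomial time (`FP`): the machine of the
proof generates the description of the `|x|`-th circuit (uniformity), keeps "(a) block locations,
(b) block states" as the blocks `blocksAfter F x j` with their integral Gram data `gramZ B (ampZ F x j)`,
updates them gate by gate by the coordinate identities of `BoundedEntanglementGramZUpdate.lean` (merge
with exact division by `2^h`, conjugation by the rescaled gate, doubling of untouched blocks at a
Hadamard gate, split tests on a column, partial traces) on tables of at most `2^{2p} × 2^{2p}` entries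
(`card_touchUnion_blocksAfter_le`) whose coordinates have `O(h)` bits, "a number of … arithmetic
operations [per gate that] does not grow with `j`", and finally applies the sign test (to be written in
the tree's `FP` brick algebra, as `QuantumComplexity/ADHMachine.lean` does for `BQP ⊆ PP`). Given `h`,
every language decided with bounded error by such a family is in `BPP` — indeed in `P`
(`mem_P_of_mem_FP`), and `P ⊆ BPP` (`P_subset_BPP_holds`). [cite: JozsaLinden2003, §3 (theorem pblthm, proof of lemma ratpbl) with §2] -/
theorem jozsaLinden2003_pblocked_of_decisionInFP
    (h : ∀ (p : ℕ) (F : QCircuitFamily cliffordT), F.IsOracleFree → F.IsUniform → F.HasPBlockedStates p →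
      (fun z => [pDecision F z]) ∈ FP) :
    jozsaLinden2003_pblocked := by
  intro p F L hF hU _ hP hacc
  refine P_subset_BPP_holds (mem_P_of_mem_FP (h p F hF hU hP) L fun x => ?_)
  have hx := mem_iff_pDecision F hF hacc x
  constructor
  · intro hxL
    rw [hx.1 hxL]
  · intro hxL
    have : pDecision F x ≠ true := fun h' => hxL (hx.2 h')
    rw [Bool.eq_false_iff.2 this]

end Literature.Barriers.QuantumAdvantage

end
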